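import Summits.Parity.GeneralizedHardyLittlewood.Theorems.VinogradovHeathBrownMainTerm

/-! # VinogradovHeathBrown (3/3) — A2, the error terms: `errorTermBound_holds : ErrorTermBound` (item
stmt-Parity-19775), the shared supports (19666, 19667), the Assembly (19778) and the TARGET
`vinogradovHeathBrown_holds : VinogradovHeathBrown` (stmt-Parity-19774) of `route-Parity-VinogradovHeathBrown`

Ledger of record: tier A, ledger **FRONTIER**; no bearing on prime pairs / parity / GHL (tribunal J 2026-08-26).
`T(Λ_N, Λ_N, f₃) − T(g_B, g_B, f₃) = T(Λ_N − g_B, Λ_N, f₃) + T(g_B, Λ_N − g_B, f₃)`; each is bounded by the Hölder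
counting lemma E5 (`holderCounting_holds`, Literature: orthogonality, Hölder (4/3,4), Cauchy–Schwarz, Parseval)
with the sup bound `C N (log N)^{−A}` on `Λ̂_N − ĝ_B` (hypothesis of E2 shape), the trivial sup / ℓ² bounds for
`Λ_N`, `g_B`, and the fourth moment of `f̂₃` (hypothesis of E4b shape): total
`≤ C′ N² (log N)^{(1−A)/4 + 3/2 + C₄/4}`. The closing section discharges E2 and E4b by the Literature theorems
and obtains the target through the route's deciding theorem `closes`. Sources: [Vaughan1997] (§3.1, Lemma 2.5),
[GreenTao2006Restriction] (majorant principle), [Vaughan1986Cubes], [HeathBrownActa2001].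

Theorems-side PORT of the cell evidence `pub/parity-ideate/parity-ideate-p2/evidence/LineEFG_tree.lean`
(KERNEL-PROVED there, farm rc 0, axioms std), re-namespaced into the route namespace (precedent
`Theorems/MaynardProductExactGlue.lean`) and re-based on the LANDED Literature modules `CubicMinorantDefs`
(p407241: the weights `vmWeight`, `gWeight`, `hbWeight`, `apWeight`, `ternarySum`, `expSumOf`),
`TernaryHolderCounting` (E5, p410251), `RoughModelPairCount` (E6, p410680), `RoughModelFourierApprox`
(E2, p410505), `HeathBrownWeightFourthMoment` (E4b, p410644), whose public lemmas replace the evidence's local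
copies. Notation: `T = ternarySum`, `Λ_N = vmWeight N`, `g_B = gWeight B N` (the `W`-rough model of level
`(log N)^B` on `[1, N]`), `f₃ = hbWeight c N` (Heath-Brown primes `x³+2y³` from the box
`X < x, y ≤ X(1+η)`, `X = (N/6)^{1/3}`, `η = (log X)^{-c}`, weight `N^{1/3} log`). Port prepared and
farm-checked by parity-ideate-p2 g5 (planner); filed by a prover seat. -/

noncomputable section

open scoped FourierTransform ArithmeticFunction
open Finset MeasureTheory Filter

namespace Summit.Parity.GeneralizedHardyLittlewood.Theses.VinogradovHeathBrown

open Literature.NumberTheory.Sieve Literature.NumberTheory.Sieve.CubicPrimes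
open Literature.NumberTheory.Sieve.CubicMinorant hiding RoughModelFourierApprox HBFourierFourthMoment
  roughModelFourierApprox_holds hbFourierFourthMoment_holds
open Literature.NumberTheory.Waring.HuaCubes

section ErrorTermProof

/-- `expSumOf` is additive: the exponential sum of `f − g`. [folklore] -/
theorem expSumOf_sub (f g : ℕ → ℝ) (N : ℕ) (α : ℝ) :
    expSumOf (f - g) N α = expSumOf f N α - expSumOf g N α := by
  unfold expSumOf
  rw [← Finset.sum_sub_distrib]
  refine Finset.sum_congr rfl fun n _ => ?_
  rw [Pi.sub_apply]; push_cast; ring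

/-- A sum over `range (N+1)` of an `Icc 1 N`-supported weight. [folklore] -/
theorem expSumOf_ite (w : ℕ → ℝ) (N : ℕ) (α : ℝ) :
    expSumOf (fun n => if n ∈ Icc 1 N then w n else 0) N α =
      ∑ n ∈ Icc 1 N, (w n : ℂ) * (𝐞 (n * α) : ℂ) := by
  simp only [expSumOf]
  rw [show (∑ n ∈ range (N + 1), (((if n ∈ Icc 1 N then w n else 0 : ℝ) : ℂ) * (𝐞 (n * α) : ℂ))) =
      ∑ n ∈ range (N + 1), (if n ∈ Icc 1 N then (w n : ℂ) * (𝐞 (n * α) : ℂ) else 0) from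
    Finset.sum_congr rfl fun n _ => by split_ifs <;> simp, ← Finset.sum_filter]
  congr 1
  ext n; simp only [mem_filter, mem_range, mem_Icc]; omega

/-- the exponential sum of `Λ_N` over `[0, N]` is the tree's `primeExpSum N`. [folklore; Vaughan1997 §3.1] -/
theorem expSumOf_vmWeight (N : ℕ) (α : ℝ) : expSumOf (vmWeight N) N α = primeExpSum N α := by
  rw [primeExpSum, ← expSumOf_ite]; rfl

/-- the exponential sum of the restricted rough model is `roughExpSum B N`. [this line] -/
theorem expSumOf_gWeight (B : ℝ) (N : ℕ) (α : ℝ) :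
    expSumOf (gWeight B N) N α = roughExpSum B N α := by
  rw [roughExpSum, ← expSumOf_ite]; rfl

/-- the exponential sum of the Heath-Brown weight is `hbExpSum c N`. [this line] -/
theorem expSumOf_hbWeight (c : ℝ) (N : ℕ) (α : ℝ) :
    expSumOf (hbWeight c N) N α = hbExpSum c N α := by
  unfold expSumOf hbExpSum
  have hI : Ico (0 + 1) (N + 1) = Icc 1 N := by
    ext n; simp only [mem_Ico, mem_Icc]; omega
  rw [Finset.range_eq_Ico, Finset.sum_eq_sum_Ico_succ_bot (Nat.succ_pos N), hI]
  simp [hbWeight]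

/-- `T(f,f,f₃) − T(g,g,f₃) = T(f−g,f,f₃) + T(g,f−g,f₃)` (bilinearity of the ternary count). [folklore; Vaughan1997 §3.1] -/
theorem ternarySum_sub_sub (f g f₃ : ℕ → ℝ) (N : ℕ) :
    ternarySum f f f₃ N - ternarySum g g f₃ N =
      ternarySum (f - g) f f₃ N + ternarySum g (f - g) f₃ N := by
  unfold ternarySum
  rw [← Finset.sum_sub_distrib, ← Finset.sum_add_distrib]
  refine Finset.sum_congr rfl fun t _ => ?_
  simp only [Pi.sub_apply]; ring

/-- `(a N^k L^m)^r = a^r N^s L^t` for `s = kr`, `t = mr`. [folklore] -/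
theorem monomial_rpow' {a N L : ℝ} (k : ℕ) (m r s t : ℝ) (hs : (k : ℝ) * r = s) (ht : m * r = t)
    (ha : 0 ≤ a) (hN : 0 ≤ N) (hL : 0 ≤ L) :
    (a * N ^ k * L ^ m) ^ r = a ^ r * N ^ s * L ^ t := by
  rw [Real.mul_rpow (by positivity) (Real.rpow_nonneg hL _), Real.mul_rpow ha (by positivity),
    ← Real.rpow_natCast N k, ← Real.rpow_mul hN, ← Real.rpow_mul hL, hs, ht]

/-- The Hölder shape `(a₁ N² L^{e₁})^{1/4} (a₂ N² L⁴)^{3/8} (a₃ N³ L^{e₃})^{1/4} =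
K N² L^{e₁/4 + 3/2 + e₃/4}`, as an inequality fed by E5. [folklore] -/
theorem holder_to_monomial {T F₁ F₂ F₃ a₁ a₂ a₃ N L e₁ e₃ : ℝ} (hN : 0 < N) (hL : 0 < L)
    (ha₁ : 0 ≤ a₁) (ha₂ : 0 ≤ a₂) (ha₃ : 0 ≤ a₃)
    (hT : |T| ≤ F₁ ^ ((1 : ℝ) / 4) * F₂ ^ ((3 : ℝ) / 8) * F₃ ^ ((1 : ℝ) / 4))
    (hF₁ : F₁ = a₁ * N ^ 2 * L ^ e₁) (hF₂0 : 0 ≤ F₂) (hF₂ : F₂ ≤ a₂ * N ^ 2 * L ^ (4 : ℝ))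
    (hF₃0 : 0 ≤ F₃) (hF₃ : F₃ ≤ a₃ * N ^ 3 * L ^ e₃) :
    |T| ≤ a₁ ^ ((1 : ℝ) / 4) * a₂ ^ ((3 : ℝ) / 8) * a₃ ^ ((1 : ℝ) / 4) * N ^ 2 *
      L ^ (e₁ / 4 + 3 / 2 + e₃ / 4) := by
  have h1 : F₁ ^ ((1 : ℝ) / 4) = a₁ ^ ((1 : ℝ) / 4) * N ^ ((1 : ℝ) / 2) * L ^ (e₁ / 4) := by
    rw [hF₁, monomial_rpow' 2 e₁ (1 / 4) (1 / 2) (e₁ / 4) (by norm_num) (by ring) ha₁ hN.le hL.le]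
  have h2 : F₂ ^ ((3 : ℝ) / 8) ≤ a₂ ^ ((3 : ℝ) / 8) * N ^ ((3 : ℝ) / 4) * L ^ ((3 : ℝ) / 2) := by
    rw [← monomial_rpow' 2 4 (3 / 8) (3 / 4) (3 / 2) (by norm_num) (by norm_num) ha₂ hN.le hL.le]
    exact Real.rpow_le_rpow hF₂0 hF₂ (by norm_num)
  have h3 : F₃ ^ ((1 : ℝ) / 4) ≤ a₃ ^ ((1 : ℝ) / 4) * N ^ ((3 : ℝ) / 4) * L ^ (e₃ / 4) := by
    rw [← monomial_rpow' 3 e₃ (1 / 4) (3 / 4) (e₃ / 4) (by norm_num) (by ring) ha₃ hN.le hL.le]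
    exact Real.rpow_le_rpow hF₃0 hF₃ (by norm_num)
  have hNm : N ^ ((1 : ℝ) / 2) * N ^ ((3 : ℝ) / 4) * N ^ ((3 : ℝ) / 4) = N ^ 2 := by
    rw [← Real.rpow_add hN, ← Real.rpow_add hN]; norm_num
  have hLm : L ^ (e₁ / 4) * L ^ ((3 : ℝ) / 2) * L ^ (e₃ / 4) = L ^ (e₁ / 4 + 3 / 2 + e₃ / 4) := by
    rw [← Real.rpow_add hL, ← Real.rpow_add hL]
  have hF2r : 0 ≤ F₂ ^ ((3 : ℝ) / 8) := Real.rpow_nonneg hF₂0 _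
  calc |T| ≤ F₁ ^ ((1 : ℝ) / 4) * F₂ ^ ((3 : ℝ) / 8) * F₃ ^ ((1 : ℝ) / 4) := hT
    _ ≤ (a₁ ^ ((1 : ℝ) / 4) * N ^ ((1 : ℝ) / 2) * L ^ (e₁ / 4)) *
          (a₂ ^ ((3 : ℝ) / 8) * N ^ ((3 : ℝ) / 4) * L ^ ((3 : ℝ) / 2)) *
          (a₃ ^ ((1 : ℝ) / 4) * N ^ ((3 : ℝ) / 4) * L ^ (e₃ / 4)) := by
        rw [h1]
        exact mul_le_mul (mul_le_mul_of_nonneg_left h2 (by positivity)) h3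
          (Real.rpow_nonneg hF₃0 _) (by positivity)
    _ = a₁ ^ ((1 : ℝ) / 4) * a₂ ^ ((3 : ℝ) / 8) * a₃ ^ ((1 : ℝ) / 4) *
          (N ^ ((1 : ℝ) / 2) * N ^ ((3 : ℝ) / 4) * N ^ ((3 : ℝ) / 4)) *
          (L ^ (e₁ / 4) * L ^ ((3 : ℝ) / 2) * L ^ (e₃ / 4)) := by ring
    _ = _ := by rw [hNm, hLm]

/-- `g ≤ P/φ(P) ≤ e⁵ log z ≤ e⁵ B log N` once `z = (log N)^B ≥ 2`. [this line] -/
theorem gWeight_le {B : ℝ} (hB : 0 < B) {N : ℕ} (hz : 2 ≤ Real.log N ^ B) (hL : 0 < Real.log N)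
    (n : ℕ) : gWeight B N n ≤ Real.exp 5 * B * Real.log N := by
  have hR : 0 ≤ Real.exp 5 * B * Real.log N := by positivity
  unfold gWeight roughModel
  split_ifs
  · calc (roughPrimorial B N : ℝ) / (Nat.totient (roughPrimorial B N) : ℝ)
          ≤ Real.exp 5 * Real.log (roughLevel B N) := primesProdBelow_div_totient_le_log hz
        _ = Real.exp 5 * (B * Real.log (Real.log N)) := by rw [roughLevel, Real.log_rpow hL]
        _ ≤ Real.exp 5 * (B * Real.log N) := by
            have h := Real.log_le_sub_one_of_pos hL
            exact mul_le_mul_of_nonneg_left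
              (mul_le_mul_of_nonneg_left (by linarith) hB.le) (Real.exp_pos 5).le
        _ = Real.exp 5 * B * Real.log N := by ring
  · exact hR
  · exact hR

/-- **A2 PROVED.** [this line] -/
theorem errorTermBound_holds : ErrorTermBound := by
  intro c hc C₄ c₁ h4 A B C hA hB N₂ h2
  have hev : ∀ᶠ N : ℕ in atTop, (2 : ℝ) ≤ Real.log N ^ B :=
    ((tendsto_rpow_atTop hB).comp
      (Real.tendsto_log_atTop.comp tendsto_natCast_atTop_atTop)).eventually_ge_atTop 2
  obtain ⟨N₇, hN₇⟩ := Filter.eventually_atTop.1 hev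
  have hC₀ : 0 < max C 1 := lt_max_of_lt_right one_pos
  have hc₁' : 0 < max c₁ 1 := lt_max_of_lt_right one_pos
  -- the constants
  refine ⟨(2 * max C 1) ^ ((1 : ℝ) / 4) * (8 * (1 + (Real.exp 5 * B) ^ 2)) ^ ((3 : ℝ) / 8) *
      (max c₁ 1) ^ ((1 : ℝ) / 4) +
    (2 * Real.exp 5 * B * max C 1) ^ ((1 : ℝ) / 4) *
      (8 * (Real.exp 5 * B) ^ 2 * (1 + (Real.exp 5 * B) ^ 2)) ^ ((3 : ℝ) / 8) *
      (max c₁ 1) ^ ((1 : ℝ) / 4), N₂ + N₇ + 3, fun N hN => ?_⟩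
  have hz := hN₇ N (by omega)
  have hN3 : 3 ≤ N := by omega
  have hN0 : (0 : ℝ) < N := by exact_mod_cast (show 0 < N by omega)
  have hN1 : (1 : ℝ) ≤ N := by exact_mod_cast (show 1 ≤ N by omega)
  have hL1 : 1 ≤ Real.log N := by
    rw [Real.le_log_iff_exp_le hN0]
    have := Real.exp_one_lt_d9
    have h3 : (3 : ℝ) ≤ N := by exact_mod_cast hN3
    linarith
  have hL0 : 0 < Real.log N := by linarith
  have hcard : ((range (N + 1)).card : ℝ) = N + 1 := by rw [Finset.card_range]; push_cast; ring
  -- sup bounds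
  have hU₁0 : 0 ≤ max C 1 * N * Real.log N ^ (-A) := by positivity
  have hsup₁ : ∀ α : ℝ, ‖expSumOf (vmWeight N - gWeight B N) N α‖ ≤ max C 1 * N * Real.log N ^ (-A) := by
    intro α
    rw [expSumOf_sub, expSumOf_vmWeight, expSumOf_gWeight]
    exact (h2 N (by omega) α).trans (mul_le_mul_of_nonneg_right
      (mul_le_mul_of_nonneg_right (le_max_left C 1) hN0.le) (Real.rpow_nonneg hL0.le _))
  have habsΛ : ∑ n ∈ range (N + 1), |vmWeight N n| ≤ 2 * N * Real.log N := by
    calc ∑ n ∈ range (N + 1), |vmWeight N n| ≤ ∑ n ∈ range (N + 1), Real.log N := by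
          refine Finset.sum_le_sum fun n hn => ?_
          rw [abs_of_nonneg (vmWeight_nonneg N n)]
          exact vmWeight_le_log (Nat.lt_succ_iff.1 (mem_range.1 hn))
      _ = (N + 1) * Real.log N := by rw [Finset.sum_const, nsmul_eq_mul, hcard]
      _ ≤ 2 * N * Real.log N := by
          have := mul_nonneg (sub_nonneg.2 hN1) hL0.le; linarith
  have hsupΛ : ∀ α : ℝ, ‖expSumOf (vmWeight N) N α‖ ≤ 2 * N * Real.log N :=
    fun α => (norm_expSumOf_le _ _ _).trans habsΛ
  have hgR := gWeight_le hB hz hL0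
  have hR0 : 0 ≤ Real.exp 5 * B * Real.log N := by positivity
  have habsg : ∑ n ∈ range (N + 1), |gWeight B N n| ≤ 2 * N * (Real.exp 5 * B * Real.log N) := by
    calc ∑ n ∈ range (N + 1), |gWeight B N n|
        ≤ ∑ n ∈ range (N + 1), Real.exp 5 * B * Real.log N := by
          refine Finset.sum_le_sum fun n _ => ?_
          rw [abs_of_nonneg (gWeight_nonneg B N n)]
          exact hgR n
      _ = (N + 1) * (Real.exp 5 * B * Real.log N) := by rw [Finset.sum_const, nsmul_eq_mul, hcard]
      _ ≤ 2 * N * (Real.exp 5 * B * Real.log N) := by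
          have := mul_nonneg (sub_nonneg.2 hN1) hR0; linarith
  have hsupg : ∀ α : ℝ, ‖expSumOf (gWeight B N) N α‖ ≤ 2 * N * (Real.exp 5 * B * Real.log N) :=
    fun α => (norm_expSumOf_le _ _ _).trans habsg
  -- ℓ² bounds
  have hsqΛ : ∑ n ∈ range (N + 1), vmWeight N n ^ 2 ≤ 2 * N * Real.log N ^ 2 := by
    calc ∑ n ∈ range (N + 1), vmWeight N n ^ 2 ≤ ∑ n ∈ range (N + 1), Real.log N ^ 2 := by
          refine Finset.sum_le_sum fun n hn => ?_
          exact pow_le_pow_left₀ (vmWeight_nonneg N n)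
            (vmWeight_le_log (Nat.lt_succ_iff.1 (mem_range.1 hn))) 2
      _ = (N + 1) * Real.log N ^ 2 := by rw [Finset.sum_const, nsmul_eq_mul, hcard]
      _ ≤ 2 * N * Real.log N ^ 2 := by
          have := mul_nonneg (sub_nonneg.2 hN1) (sq_nonneg (Real.log N)); linarith
  have hsqg : ∑ n ∈ range (N + 1), gWeight B N n ^ 2 ≤
      2 * N * (Real.exp 5 * B * Real.log N) ^ 2 := by
    calc ∑ n ∈ range (N + 1), gWeight B N n ^ 2
        ≤ ∑ n ∈ range (N + 1), (Real.exp 5 * B * Real.log N) ^ 2 := by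
          refine Finset.sum_le_sum fun n _ => ?_
          exact pow_le_pow_left₀ (gWeight_nonneg B N n) (hgR n) 2
      _ = (N + 1) * (Real.exp 5 * B * Real.log N) ^ 2 := by
          rw [Finset.sum_const, nsmul_eq_mul, hcard]
      _ ≤ 2 * N * (Real.exp 5 * B * Real.log N) ^ 2 := by
          have := mul_nonneg (sub_nonneg.2 hN1) (sq_nonneg (Real.exp 5 * B * Real.log N))
          linarith
  have hsqd : ∑ n ∈ range (N + 1), (vmWeight N - gWeight B N) n ^ 2 ≤
      4 * (1 + (Real.exp 5 * B) ^ 2) * N * Real.log N ^ 2 := by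
    calc ∑ n ∈ range (N + 1), (vmWeight N - gWeight B N) n ^ 2
        ≤ ∑ n ∈ range (N + 1), (2 * vmWeight N n ^ 2 + 2 * gWeight B N n ^ 2) := by
          refine Finset.sum_le_sum fun n _ => ?_
          rw [Pi.sub_apply]
          nlinarith [sq_nonneg (vmWeight N n + gWeight B N n)]
      _ = 2 * ∑ n ∈ range (N + 1), vmWeight N n ^ 2 + 2 * ∑ n ∈ range (N + 1), gWeight B N n ^ 2 := by
          rw [Finset.sum_add_distrib, Finset.mul_sum, Finset.mul_sum]
      _ ≤ 2 * (2 * N * Real.log N ^ 2) + 2 * (2 * N * (Real.exp 5 * B * Real.log N) ^ 2) := by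
          linarith
      _ = 4 * (1 + (Real.exp 5 * B) ^ 2) * N * Real.log N ^ 2 := by ring
  -- the fourth moment
  have hI0 : 0 ≤ ∫ α in (0 : ℝ)..1, ‖expSumOf (hbWeight c N) N α‖ ^ 4 :=
    intervalIntegral.integral_nonneg zero_le_one fun α _ => by positivity
  have hI : ∫ α in (0 : ℝ)..1, ‖expSumOf (hbWeight c N) N α‖ ^ 4 ≤
      max c₁ 1 * (N : ℝ) ^ 3 * Real.log N ^ C₄ := by
    simp_rw [expSumOf_hbWeight]
    exact (h4 N hN3).trans (mul_le_mul_of_nonneg_right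
      (mul_le_mul_of_nonneg_right (le_max_left c₁ 1) (by positivity)) (Real.rpow_nonneg hL0.le _))
  have hL4 : Real.log N ^ 2 * Real.log N ^ 2 = Real.log N ^ (4 : ℝ) := by
    rw [show Real.log N ^ (4 : ℝ) = Real.log N ^ (4 : ℕ) by exact_mod_cast Real.rpow_natCast _ 4]
    ring
  have hLA : Real.log N ^ (-A) * Real.log N = Real.log N ^ (1 - A) := by
    rw [show (1 : ℝ) - A = -A + 1 by ring, Real.rpow_add_one hL0.ne']
  -- term 1: `T(Λ − g, Λ, f₃)`
  have hT₁ := holderCounting_holds (vmWeight N - gWeight B N) (vmWeight N) (hbWeight c N) N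
    _ _ hU₁0 (by positivity) hsup₁ hsupΛ
  have hS₁0 : 0 ≤ (∑ n ∈ range (N + 1), (vmWeight N - gWeight B N) n ^ 2) *
      ∑ n ∈ range (N + 1), vmWeight N n ^ 2 :=
    mul_nonneg (Finset.sum_nonneg fun n _ => sq_nonneg _) (Finset.sum_nonneg fun n _ => sq_nonneg _)
  have hS₁ : (∑ n ∈ range (N + 1), (vmWeight N - gWeight B N) n ^ 2) *
      ∑ n ∈ range (N + 1), vmWeight N n ^ 2 ≤
      8 * (1 + (Real.exp 5 * B) ^ 2) * N ^ 2 * Real.log N ^ (4 : ℝ) := by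
    calc (∑ n ∈ range (N + 1), (vmWeight N - gWeight B N) n ^ 2) *
          ∑ n ∈ range (N + 1), vmWeight N n ^ 2
        ≤ (4 * (1 + (Real.exp 5 * B) ^ 2) * N * Real.log N ^ 2) * (2 * N * Real.log N ^ 2) :=
          mul_le_mul hsqd hsqΛ (Finset.sum_nonneg fun n _ => sq_nonneg _) (by positivity)
      _ = 8 * (1 + (Real.exp 5 * B) ^ 2) * N ^ 2 * (Real.log N ^ 2 * Real.log N ^ 2) := by ring
      _ = _ := by rw [hL4]
  have hb₁ := holder_to_monomial (T := ternarySum (vmWeight N - gWeight B N) (vmWeight N) (hbWeight c N) N)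
    hN0 hL0 (by positivity : (0 : ℝ) ≤ 2 * max C 1) (by positivity) hc₁'.le hT₁
    (by rw [← hLA]; ring) hS₁0 hS₁ hI0 hI
  -- term 2: `T(g, Λ − g, f₃)`
  have hT₂ := holderCounting_holds (gWeight B N) (vmWeight N - gWeight B N) (hbWeight c N) N
    _ _ (by positivity) hU₁0 hsupg hsup₁
  have hS₂0 : 0 ≤ (∑ n ∈ range (N + 1), gWeight B N n ^ 2) *
      ∑ n ∈ range (N + 1), (vmWeight N - gWeight B N) n ^ 2 :=
    mul_nonneg (Finset.sum_nonneg fun n _ => sq_nonneg _) (Finset.sum_nonneg fun n _ => sq_nonneg _)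
  have hS₂ : (∑ n ∈ range (N + 1), gWeight B N n ^ 2) *
      ∑ n ∈ range (N + 1), (vmWeight N - gWeight B N) n ^ 2 ≤
      8 * (Real.exp 5 * B) ^ 2 * (1 + (Real.exp 5 * B) ^ 2) * N ^ 2 * Real.log N ^ (4 : ℝ) := by
    calc (∑ n ∈ range (N + 1), gWeight B N n ^ 2) *
          ∑ n ∈ range (N + 1), (vmWeight N - gWeight B N) n ^ 2
        ≤ (2 * N * (Real.exp 5 * B * Real.log N) ^ 2) *
            (4 * (1 + (Real.exp 5 * B) ^ 2) * N * Real.log N ^ 2) :=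
          mul_le_mul hsqg hsqd (Finset.sum_nonneg fun n _ => sq_nonneg _) (by positivity)
      _ = 8 * (Real.exp 5 * B) ^ 2 * (1 + (Real.exp 5 * B) ^ 2) * N ^ 2 *
            (Real.log N ^ 2 * Real.log N ^ 2) := by ring
      _ = _ := by rw [hL4]
  have hb₂ := holder_to_monomial (T := ternarySum (gWeight B N) (vmWeight N - gWeight B N) (hbWeight c N) N)
    hN0 hL0 (by positivity : (0 : ℝ) ≤ 2 * Real.exp 5 * B * max C 1) (by positivity) hc₁'.le hT₂
    (by rw [← hLA]; ring) hS₂0 hS₂ hI0 hI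
  -- combine
  rw [ternarySum_sub_sub]
  refine (abs_add_le _ _).trans ?_
  have hsum := add_le_add hb₁ hb₂
  refine hsum.trans (le_of_eq ?_)
  ring

end ErrorTermProof

/-! ## The shared supports, the Assembly and the target (items 19666, 19667, 19778, 19774) -/

section Closing

/-- **stmt-Parity-19666 (support E2).** The route decl `RoughModelFourierApprox` has the same body as the
Literature fact of the same name; closed by the Literature theorem (p410505). [Vaughan1997 §3.1] -/
theorem roughModelFourierApprox_holds : RoughModelFourierApprox :=
  Literature.NumberTheory.Sieve.CubicMinorant.roughModelFourierApprox_holds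

/-- **stmt-Parity-19667 (support E4b).** The route decl `HBFourierFourthMoment` has the same body as the
Literature fact of the same name; closed by the Literature theorem (p410644, from Hua's lemma with logs
p406333). [Vaughan1986Cubes; Vaughan1997 Lemma 2.5] -/
theorem hbFourierFourthMoment_holds : HBFourierFourthMoment :=
  Literature.NumberTheory.Sieve.CubicMinorant.hbFourierFourthMoment_holds

/-- **stmt-Parity-19778 (assembly).** `MainTermLower → ErrorTermBound → Readout → RoughModelFourierApprox →
HBFourierFourthMoment → VinogradovHeathBrown` is exactly the route's deciding theorem `closes`. -/
theorem assembly_holds : Assembly := fun h₁ h₂ h₃ hE2 hE4b => closes h₁ h₂ h₃ hE2 hE4b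

/-- **stmt-Parity-19774 (target = rung leaf F-P1): every large odd `N` is `p + q + (x³ + 2y³)` with all
three summands prime, `x, y ≥ 1`, and the Heath-Brown prime exceeding `N/2`.** All five hypotheses of
`closes` are theorems (this file and its two predecessors, and the Literature supports). Ledger FRONTIER;
no bearing on prime pairs / parity / GHL. [HeathBrownActa2001, Vinogradov1937] -/
theorem vinogradovHeathBrown_holds : VinogradovHeathBrown :=
  closes mainTermLower_holds errorTermBound_holds readout_holds roughModelFourierApprox_holds
    hbFourierFourthMoment_holds

end Closing

end Summit.Parity.GeneralizedHardyLittlewood.Theses.VinogradovHeathBrown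

end
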